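import Summits.NavierStokesRegularity.FluidComputer.PalasekTowerClayBridge

/-!
# The super-lacunary derivative ledger is summable (Palasek's force budget feeds `clayForce_of_summable_levels`)

Cell `ns-blowup`, seat `ns-blowup-ecbridge-1`; companion of `PalasekTowerClayBridge.lean` and
`PalasekTowerForceBudget.lean` (LABEL: E-C typing; WHAT THIS IS NOT: not Navier–Stokes — real
analysis of one series). Palasek's force estimate (arXiv:2605.13827 §3.3, (exp_small)):
`‖∂ₜ^m g_k‖_{𝒞^σ} ≲ N_k^{2+σ+…} A_k · exp(-(c/4) A_{k-1}/A_{k-2})`, i.e. a POLYNOMIAL in `N_k` times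
`exp(-c' N_{k-2}^{β(b-1)})`. `clayForce_of_summable_levels` asks that such bounds be SUMMABLE in
`k` for every derivative order; this file proves it once and for all for super-lacunary scales:
for `x_{k+1} = x_k^b`, `b > 1`, `x_k → ∞`, every `x_k^q exp(-c x_k)` (`c > 0`) is summable (ratio
test: the ratio is `x_k^{q(b-1)} exp(-c(x_k^b - x_k)) → 0`), and hence, for the tower scales
`N_k = N₀^{b^k}`, `Σ_k N_{k+2}^s exp(-c N_k^γ) < ∞` for all real `s` and `γ > 0`, `c > 0` — the shape
of every entry of the R2 / R11 derivative ledger (ecbridge-2 memo R11) with `γ = β(b-1)`.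

References: S. Palasek, arXiv:2605.13827 §3.3 (exp_small) [cite: Palasek2026ElementaryModel, §3.3].
-/

noncomputable section

namespace Summit.NavierStokesRegularity.FluidComputer.PalasekTowerClayBridge

open Set Filter Topology Function Real
open scoped ContDiff

/-- **Ratio-test summability along a super-lacunary sequence.** If `x_k > 0`, `x_{k+1} = x_k^b`
with `b > 1` and `x_k → ∞`, then `Σ_k x_k^q e^{-c x_k} < ∞` for every real `q` and every `c > 0`:
eventually `x_k^{b-1} ≥ 2`, so `e^{-c x_k^b} ≤ e^{-c x_k} e^{-(c/2) x_k^b}`, and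
`x_k^{q(b-1)} e^{-(c/2) x_k^b} → 0`, so the ratio of consecutive terms is eventually `≤ 1/2`. [folklore] -/
theorem summable_rpow_mul_exp_neg_of_superlacunary {x : ℕ → ℝ} {b c : ℝ} (q : ℝ) (hb : 1 < b)
    (hc : 0 < c) (hx0 : ∀ k, 0 < x k) (hrec : ∀ k, x (k + 1) = x k ^ b)
    (hx : Tendsto x atTop atTop) :
    Summable (fun k => x k ^ q * Real.exp (-(c * x k))) := by
  set f : ℕ → ℝ := fun k => x k ^ q * Real.exp (-(c * x k)) with hfdef
  have hfpos : ∀ k, 0 < f k := fun k => mul_pos (Real.rpow_pos_of_pos (hx0 k) _) (Real.exp_pos _)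
  -- (E1) eventually `2 ≤ x_k^{b-1}`
  have hE1 : ∀ᶠ k in atTop, 2 ≤ x k ^ (b - 1) :=
    ((tendsto_rpow_atTop (by linarith : 0 < b - 1)).comp hx).eventually (eventually_ge_atTop 2)
  -- (E2) eventually `x_k^{q(b-1)} exp(-(c/2) x_k^b) ≤ 1/2`
  have hxb : Tendsto (fun k => x k ^ b) atTop atTop :=
    (tendsto_rpow_atTop (by linarith : 0 < b)).comp hx
  have hG : Tendsto (fun k => (x k ^ b) ^ (q * (b - 1) / b) * Real.exp (-(c / 2) * (x k ^ b)))
      atTop (𝓝 0) :=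
    (tendsto_rpow_mul_exp_neg_mul_atTop_nhds_zero (q * (b - 1) / b) (c / 2) (by linarith)).comp hxb
  have hGeq : ∀ k, (x k ^ b) ^ (q * (b - 1) / b) = x k ^ (q * (b - 1)) := by
    intro k
    rw [← Real.rpow_mul (hx0 k).le]
    congr 1
    field_simp
  have hE2 : ∀ᶠ k in atTop, x k ^ (q * (b - 1)) * Real.exp (-(c / 2) * (x k ^ b)) ≤ 1 / 2 := by
    have h := (tendsto_order.1 hG).2 (1 / 2) (by norm_num)
    filter_upwards [h] with k hk
    rw [hGeq k] at hk
    exact hk.le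
  -- ratio estimate
  have hratio : ∀ᶠ k in atTop, ‖f (k + 1)‖ ≤ (1 / 2) * ‖f k‖ := by
    filter_upwards [hE1, hE2] with k h1 h2
    have hxk : 0 < x k := hx0 k
    rw [Real.norm_of_nonneg (hfpos _).le, Real.norm_of_nonneg (hfpos _).le]
    simp only [hfdef, hrec k]
    -- `(x^b)^q = x^q * x^{q(b-1)}`
    have hpow : (x k ^ b) ^ q = x k ^ q * x k ^ (q * (b - 1)) := by
      rw [← Real.rpow_mul hxk.le, ← Real.rpow_add hxk]
      congr 1
      ring
    -- `x^b ≥ 2 x`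
    have hxb2 : 2 * x k ≤ x k ^ b := by
      have : x k ^ b = x k * x k ^ (b - 1) := by
        rw [← Real.rpow_one_add' hxk.le (by linarith : 1 + (b - 1) ≠ 0)]
        congr 1
        ring
      rw [this, mul_comm (x k) (x k ^ (b - 1))]
      exact mul_le_mul_of_nonneg_right h1 hxk.le
    -- `exp(-c x^b) ≤ exp(-c x) * exp(-(c/2) x^b)`
    have hexp : Real.exp (-(c * x k ^ b)) ≤
        Real.exp (-(c * x k)) * Real.exp (-(c / 2) * (x k ^ b)) := by
      rw [← Real.exp_add]
      apply Real.exp_le_exp.2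
      nlinarith
    calc (x k ^ b) ^ q * Real.exp (-(c * x k ^ b))
        ≤ (x k ^ q * x k ^ (q * (b - 1))) *
            (Real.exp (-(c * x k)) * Real.exp (-(c / 2) * (x k ^ b))) := by
          rw [hpow]
          exact mul_le_mul_of_nonneg_left hexp (by positivity)
      _ = (x k ^ (q * (b - 1)) * Real.exp (-(c / 2) * (x k ^ b))) *
            (x k ^ q * Real.exp (-(c * x k))) := by ring
      _ ≤ (1 / 2) * (x k ^ q * Real.exp (-(c * x k))) :=
          mul_le_mul_of_nonneg_right h2 (hfpos k).le
  exact summable_of_ratio_norm_eventually_le (by norm_num : (1 : ℝ) / 2 < 1) hratio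

namespace TowerRates

variable (R : TowerRates)

/-- The double-exponential recursion of the scales: `N_{k+1} = N_k^b`. [cite: Palasek2026ElementaryModel, §1.2] -/
theorem N_succ (k : ℕ) : R.N (k + 1) = R.N k ^ R.b := by
  simp only [TowerRates.N]
  rw [← Real.rpow_mul (le_trans zero_le_one R.one_lt_N₀.le), pow_succ]

/-- Two steps of the recursion: `N_{k+2} = N_k^{b²}`. [cite: Palasek2026ElementaryModel, §1.2] -/
theorem N_succ_succ (k : ℕ) : R.N (k + 2) = R.N k ^ (R.b ^ 2) := by
  rw [show k + 2 = (k + 1) + 1 from rfl, R.N_succ (k + 1), R.N_succ k,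
    ← Real.rpow_mul (R.N_pos k).le, sq]

/-- **Palasek's derivative ledger is summable.** For the tower scales `N_k = N₀^{b^k}` and any
real `s` and `γ > 0`, `c > 0`: `Σ_k N_{k+2}^s · exp(-c N_k^γ) < ∞`. With `γ = β(b-1)` and
`c = c₀/4` this is the shape of every `C^m`-bound of the R2 schedule force
(`N_k^{2+m+β} exp(-(c₀/4) A_{k-1}/A_{k-2})`, `A_{k-1}/A_{k-2} = N_{k-2}^{β(b-1)}`), so
`clayForce_of_summable_levels` applies to it. Proof: `x_k := N_k^γ` satisfies `x_{k+1} = x_k^b`,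
and `N_{k+2}^s = x_k^{b² s/γ}`. [cite: Palasek2026ElementaryModel, §3.3] -/
theorem summable_ledger (s : ℝ) {γ c : ℝ} (hγ : 0 < γ) (hc : 0 < c) :
    Summable (fun k => R.N (k + 2) ^ s * Real.exp (-(c * R.N k ^ γ))) := by
  have hb := R.one_lt_b
  set x : ℕ → ℝ := fun k => R.N k ^ γ with hxdef
  have hx0 : ∀ k, 0 < x k := fun k => Real.rpow_pos_of_pos (R.N_pos k) _
  have hrec : ∀ k, x (k + 1) = x k ^ R.b := by
    intro k
    simp only [hxdef]
    rw [R.N_succ k, ← Real.rpow_mul (R.N_pos k).le, ← Real.rpow_mul (R.N_pos k).le, mul_comm]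
  have hx : Tendsto x atTop atTop := (tendsto_rpow_atTop hγ).comp R.tendsto_N_atTop
  have h := summable_rpow_mul_exp_neg_of_superlacunary (R.b ^ 2 * s / γ) hb hc hx0 hrec hx
  refine h.congr fun k => ?_
  show (R.N k ^ γ) ^ (R.b ^ 2 * s / γ) * Real.exp (-(c * R.N k ^ γ)) =
    R.N (k + 2) ^ s * Real.exp (-(c * R.N k ^ γ))
  congr 1
  rw [R.N_succ_succ k, ← Real.rpow_mul (R.N_pos k).le, ← Real.rpow_mul (R.N_pos k).le]
  congr 1
  field_simp

end TowerRates

end Summit.NavierStokesRegularity.FluidComputer.PalasekTowerClayBridge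

end
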